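import Summits.ResolutionOfSingularities.ResolutionOfSingularities.Theorems.EquisingularLiftEquisingularLiftNatF102IsoOfCharts
import Summits.ResolutionOfSingularities.ResolutionOfSingularities.Theorems.EquisingularLiftEquisingularLiftNatP1VBReductionSections
import Summits.ResolutionOfSingularities.ResolutionOfSingularities.Theorems.EquisingularLiftEquisingularLiftNatRationalCarrierInfinite
import Summits.ResolutionOfSingularities.ResolutionOfSingularities.Theorems.EquisingularLiftEquisingularLiftProjectiveAmbientSmoothProper
import Literature.AlgebraicGeometry.Morphisms.ProperGenericFibreDim
import Literature.AlgebraicGeometry.Dimension.SmoothRelativeDimensionBound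
import Literature.AlgebraicGeometry.Morphisms.CechH1Projective
import Mathlib.AlgebraicGeometry.Morphisms.UniversallyOpen
import Mathlib.RingTheory.DiscreteValuationRing.TFAE
import HarnessLib

/-!
# [OURS · L1 W4.5(b) · LINE (T-j)-PROOF, GLUE G4] A morphism `C → ℙ¹_O` over `Spec O` mapping the closed fibre onto the closed fibre
# is dominant

Cell res-hironaka, LADDER-RESOLUTION rung L, slot W4.5(b), crux chain w45b: EL♮(3) = stmt-ResolutionOfSingularities-20148, residue
(T-j) = F-102 `Literature.AlgebraicGeometry.Resolution.GenusZeroOverCompleteDVR` (LINE (T-j)-PROOF, res-L1-w45b-lead-2 g3; skeleton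
`L/res-L1-w45b-lead-2/F102Skeleton.lean`, glue G4 `genericPoints_subset_range`). `--supports stmt-ResolutionOfSingularities-20148 --as
helper`. NOT a statement of any manuscript; OURS; AI-written, weaker than expert review. No `sorry`; standard axioms; DEF-FREE.

THEOREM (`genericPoints_subset_range`). `O` a discrete valuation ring, `θ : O ↠ k`, `f : C → Spec O` proper flat with `C` integral,
`(i, t)` cartesian over `Spec θ` with `Ck ≅ ℙ¹_{k'}`, `φ : C → ℙ¹_O` over `f` injective on the closed fibre and mapping it ONTO the closed
fibre of `ℙ¹_O`. Then the generic point of `ℙ¹_O` is in the image of `φ` (`genericPoints ℙ¹_O ⊆ range φ`).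

PROOF. `f` is flat, hence generalising, so `f(ξ_C)` is the generic point of `Spec O` and `y₀ := φ(ξ_C)` is off the closed fibre. If
`y₀` were not the generic point of the integral `ℙ¹_O` (res-L1-type-o6's `isIntegral_PP`), then `1 ≤ dim 𝒪_{y₀}`, the stalks of
`ℙ¹_O` have dimension `≤ dim O + 1 = 2` (smooth of relative dimension `1`, tree `ringKrullDim_stalk_le_of_smoothOfRelativeDimension_of_…`),
so `closure {y₀}` meets the closed fibre in a FINITE set (res-D-pv-035's `finite_closure_singleton_inter_closedFibre`); but
`closure {y₀} ⊇ φ(C) ⊇ φ(i(Ck))` = the whole closed fibre, an injective image of the infinite `Ck ≅ ℙ¹_{k'}` — contradiction.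
-/

noncomputable section

open CategoryTheory AlgebraicGeometry TopologicalSpace Opposite IsLocalRing
open Literature.AlgebraicGeometry Literature.AlgebraicGeometry.Morphisms Literature.AlgebraicGeometry.Motives
open Literature.AlgebraicGeometry.Dimension

set_option linter.dupNamespace false -- mandated namespace `Summit.<Summit>.<Problem>` of this single-conjunct summit

namespace Summit.ResolutionOfSingularities.ResolutionOfSingularities.Cruxes.EquisingularLiftNat.F102

/-- A flat morphism to `Spec` of a domain maps the generic point of an irreducible source to the generic point (flat ⇒
generalising). [folklore] -/
theorem apply_genericPoint_eq_bot_of_flat {O : Type} [CommRing O] [IsDomain O] {C : Scheme.{0}} [IrreducibleSpace C]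
    (f : C ⟶ Spec (.of O)) [Flat f] :
    f.base (genericPoint C) = (⟨⊥, Ideal.isPrime_bot⟩ : PrimeSpectrum O) := by
  set η : PrimeSpectrum O := ⟨⊥, Ideal.isPrime_bot⟩
  have hgen : η ⤳ f.base (genericPoint C) := (PrimeSpectrum.le_iff_specializes η _).mp bot_le
  obtain ⟨x, -, hx⟩ := Flat.generalizingMap f hgen
  have h1 : f.base (genericPoint C) ⤳ f.base x := (genericPoint_specializes x).map f.base.hom.continuous
  rw [hx] at h1
  have h2 : (f.base (genericPoint C)).asIdeal ≤ η.asIdeal := (PrimeSpectrum.le_iff_specializes _ _).mpr h1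
  exact PrimeSpectrum.ext (le_bot_iff.mp h2)

/-- **GLUE G4 — `φ` is dominant.** [OURS] -/
theorem genericPoints_subset_range (O : Type) [CommRing O] [IsDomain O] [IsDiscreteValuationRing O]
    [IsAdicComplete (maximalIdeal O) O] (k : Type) [Field k] [IsAlgClosed k] (θ : O →+* k)
    (C : Scheme.{0}) (f : C ⟶ Spec (.of O)) [IsProper f] [Flat f]
    (Ck : Scheme.{0}) (i : Ck ⟶ C) (t : Ck ⟶ Spec (.of k)) [IsIntegral C]
    (hθ : Function.Surjective θ) (hsq : IsPullback i t f (Spec.map (CommRingCat.ofHom θ)))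
    (hP1 : ∃ (k' : Type) (_ : Field k'), Nonempty (Ck ≅ ProjCech.PP k' 1))
    (φ : C ⟶ ProjCech.PP O 1) (hφ : φ ≫ ProjCech.toSpec O 1 = f)
    (hinj : ∀ y : ProjCech.PP O 1, ProjCech.toSpec O 1 y = closedPoint O → (φ.base ⁻¹' {y}).Subsingleton)
    (hsurj : Set.range (i ≫ φ).base = (ProjCech.toSpec O 1).base ⁻¹' {closedPoint O}) :
    genericPoints (ProjCech.PP O 1) ⊆ Set.range φ.base := by
  obtain ⟨k', _, ⟨e⟩⟩ := hP1
  haveI : IsIntegral (ProjCech.PP O 1) := isIntegral_PP O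
  haveI : IsProper (ProjCech.toSpec O 1) := ProjBaseChangeRing.isProper_projToSpec (Fin 2) O
  haveI : SmoothOfRelativeDimension 1 (ProjCech.toSpec O 1) :=
    EquisingularLift.StrataSplit.smoothOfRelativeDimension_toSpecZero_specMap 1 O
  haveI : IsLocallyNoetherian (ProjCech.PP O 1) := LocallyOfFiniteType.isLocallyNoetherian (ProjCech.toSpec O 1)
  haveI : IsClosedImmersion i := P1VB.isClosedImmersion_of_isPullback θ f hθ hsq
  rw [genericPoints_eq_singleton, Set.singleton_subset_iff]
  let ξ := genericPoint C
  let y₀ := φ.base ξ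
  -- `y₀` is off the closed fibre
  have hfξ : f.base ξ ≠ closedPoint O := by
    rw [apply_genericPoint_eq_bot_of_flat f]
    intro h
    have h' : (⊥ : Ideal O) = maximalIdeal O := congrArg PrimeSpectrum.asIdeal h
    exact (IsDiscreteValuationRing.not_isField O) (IsLocalRing.isField_iff_maximalIdeal_eq.mpr h'.symm)
  have hy₀π : ProjCech.toSpec O 1 y₀ ≠ closedPoint O := by
    change (φ ≫ ProjCech.toSpec O 1).base ξ ≠ _
    rw [hφ]; exact hfξ
  by_contra hne
  have hne' : y₀ ≠ genericPoint (ProjCech.PP O 1) := fun h => hne ⟨ξ, h⟩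
  -- dimension inputs on `ℙ¹_O`
  have h2 : ∀ z : ProjCech.PP O 1, ringKrullDim ((ProjCech.PP O 1).presheaf.stalk z) ≤ ((2 : ℕ) : WithBot ℕ∞) := fun z => by
    have h := ringKrullDim_stalk_le_of_smoothOfRelativeDimension_of_isNoetherianRing (ProjCech.toSpec O 1) 1 z
    have hO : ringKrullDim (CommRingCat.of O) = 1 := IsDiscreteValuationRing.ringKrullDim_eq_one O
    rw [hO] at h
    exact h.trans (by norm_num)
  have hx1 : (1 : WithBot ℕ∞) ≤ ringKrullDim ((ProjCech.PP O 1).presheaf.stalk y₀) :=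
    one_le_ringKrullDim_stalk_of_ne_genericPoint y₀ hne'
  obtain ⟨hfin, -⟩ := finite_closure_singleton_inter_closedFibre (ProjCech.toSpec O 1) h2 y₀ hy₀π hx1
  -- the closed fibre of `ℙ¹_O` lies in `closure {y₀}`
  have hsub : (ProjCech.toSpec O 1).base ⁻¹' {closedPoint O} ⊆ closure {y₀} ∩ (ProjCech.toSpec O 1).base ⁻¹' {closedPoint O} := by
    intro w hw
    refine ⟨?_, hw⟩
    rw [← hsurj] at hw
    obtain ⟨z, rfl⟩ := hw
    have hcl : closure ({ξ} : Set C) = Set.univ := genericPoint_spec C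
    have h1 : φ.base (i.base z) ∈ φ.base '' closure ({ξ} : Set C) := ⟨i.base z, by rw [hcl]; trivial, rfl⟩
    have h2 := image_closure_subset_closure_image φ.base.hom.continuous h1
    rwa [Set.image_singleton] at h2
  -- … and is infinite
  have hinf : ((ProjCech.toSpec O 1).base ⁻¹' {closedPoint O}).Infinite := by
    rw [← hsurj, Scheme.Hom.comp_base, TopCat.coe_comp, Set.range_comp]
    haveI : Infinite (ProjCech.PP k' 1) := Sections.infinite_projectiveLine k'
    haveI : Infinite Ck := Infinite.of_injective _ e.inv.homeomorph.injective
    refine Set.Infinite.image (fun a ha b hb hab => ?_) (Set.infinite_range_of_injective i.isClosedEmbedding.injective)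
    have hker : RingHom.ker θ = maximalIdeal O := IsLocalRing.eq_maximalIdeal (RingHom.ker_isMaximal_of_surjective θ hθ)
    haveI : IsLocalHom θ := by
      refine ⟨fun r hr => ?_⟩
      by_contra h
      have hmem : r ∈ RingHom.ker θ := by rw [hker]; exact (IsLocalRing.mem_maximalIdeal r).mpr h
      exact hr.ne_zero ((RingHom.mem_ker).mp hmem)
    have hover : ∀ c ∈ Set.range i.base, ProjCech.toSpec O 1 (φ.base c) = closedPoint O := by
      rintro _ ⟨z, rfl⟩
      change ((i ≫ φ) ≫ ProjCech.toSpec O 1).base z = _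
      rw [Category.assoc, hφ, hsq.w]
      change (Spec.map (CommRingCat.ofHom θ)).base (t.base z) = _
      rw [Subsingleton.elim (t.base z) (closedPoint k)]
      exact Spec_closedPoint (f := CommRingCat.ofHom θ)
    exact hinj (φ.base a) (hover a ha) (Set.mem_preimage.mpr rfl) (Set.mem_preimage.mpr hab.symm)
  exact hinf (hfin.subset hsub)

end Summit.ResolutionOfSingularities.ResolutionOfSingularities.Cruxes.EquisingularLiftNat.F102

end
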